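/-
Copyright (c) 2026 the pub-hodgecm-mathlib formalisation cell (harness21).  Prover seat hodgecm-mathlib-A-p19 (g19), topic T5 = P8
«(C♯)hol interior», node Cc (3′) — THE LETTER-LEVEL CLOSER (assembler role, desk F0P2-plan (g8) 21:36:48Z).  KERNEL: theorems only.
-/
import Summits.HodgeConjecture.HodgeConjecture.Theorems.F0P2oCcThetaFunctionalCovariance
import Summits.HodgeConjecture.HodgeConjecture.Theorems.F0P3HolProjectionReduction
import Summits.HodgeConjecture.HodgeConjecture.Theorems.F0P2aCohFormsContinuous
import Literature.NumberTheory.GelbartRogawski1991.ArchLocalUnitarySurjective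
import Literature.NumberTheory.GelbartRogawski1991.DoubledWeilRepresentationArchPlaceHermite
import Literature.NumberTheory.Automorphic.Liu2021.ThetaLiftFromLineArchTypes
import Literature.NumberTheory.GelbartRogawski1991.QuadExtSplittingCharArchType
import Literature.NumberTheory.Automorphic.IdeleClassBaseChangePosReal
import Literature.NumberTheory.Automorphic.IdeleClassCharacterHecke
import Literature.NumberTheory.Automorphic.ConjugateSelfDualInfinityType
import HarnessLib

/-!
# Node Cc of the (C♯)hol interior HOLDS — ★ `Liu2021.meetsThetaLiftFromLine_hol_archTypeAway` (p826262) PROVED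
# ([Liu2021, App. D Lem. D.2 (1)]: «among the `ω_{n,0}^{m,±,l}` only `ω^{1,+,0}` and `ω^{−1,−,0}` are the trivial character»)

Topic `Summits/HodgeConjecture` (T5 = P8 «(C♯)hol interior», node Cc); namespace `Summit.HodgeConjecture.HodgeConjecture.Cruxes.H413.F0P2oCcArchTypeAwayHolds`.
KERNEL ONLY: one proved theorem, hypothesis-free; 0 definitions, 0 records, 0 `sorry`.

`meetsThetaLiftFromLine_hol_archTypeAway_holds : Liu2021.meetsThetaLiftFromLine_hol_archTypeAway` — in the (C♯)hol frame, a discrete `P` of `U(H)` meeting the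
theta lift from the line `⟨a⟩` at the `μ`-splitting and holomorphic-cotangent at `ι` relative to `K_c` has, at every embedding `τ′` off the place of `ι`, raw
archimedean parameters `(m, sign) ∈ {(−1, −), (1, +)}`.  PROOF (the Cc (3′) road, all inputs ★): `CompactSpace [U(H)]` (★ `compactSpace_automorphicQuotient_cm`);
`ιA = cmAdelicFrameTransport` (★ S4 `eq_cmAdelicFrameTransport_of_coe`); `IsHolCotangentAt` ⇒ a non-zero coordinate class in `P` (★ `exists_toLp_ne_zero_of_mem_cohForms_cm`);
a PURE-TENSOR theta witness `Φ_∞ ⊗ Φ_f` with `pr_P [Θ̃_{Φ_∞ ⊗ Φ_f}] ≠ 0` (★ node B (1b) `MeetsThetaLiftFromLine.exists_chi_starProjection_ne_zero_of_holCotForm_tensor`);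
`w₀ :=` the place of `τ′` `= cmPlaceOver L v₀` (★ `comap_injective_of_isCMField`); `τ := hμ.infinityType` (★ `hasUnitaryArchType_toHeckeCharacter_iff`,
★ `odd_infinityType`); `σ_{v₀}(dV p) > 0` (★ S3a `embedding_of_isReal_dV_pos_of_posDef`) and the sign split (★ `forall_signVec_pos_or_forall_not_of_line`); the
CORE ★ `starProjection_toLp_lineThetaLift_tmul_eq_zero_of_pos/_of_neg` over ★ S1 (`exists_archLocal_entries_eq_of_pos/_of_neg`, F0P2-p02) and ★ β-II
(`carrierConjEquiv_frameD_placeBlock_mulSingle_doubled_archBoxTensor`, F0P3a-p03) kills the witness unless `τ_{w₀} = ∓1`; the dictionary ★ `exponentAt_embedding` /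
★ `exponentAt_conjugate_embedding` / Mathlib `InfinitePlace.mk_eq_iff` / ★ S3b `im_embedding_cmPlaceOver_mul_inv_two_imagUnit` gives the letter's disjunction.

HONEST SCOPE.  This proves ONE booked letter of the (C♯)hol interior (node Cc); HC_CM is NOT proved here or anywhere in the tree — it stays conditional on the
remaining named inputs (hLiu418, h413) until rung 0 closes.

References: [Liu2021] proof of Prop. 4.13 Case 1 (l. 2137–2141, p. 48), App. D Lem. D.2 (1) (l. 5283), Rem. 4.2 / Def. 4.3; [KonnoKonno2007] Thm. 5.4,
Lemma 5.2; [KashiwaraVergne1978] (5.1)–(5.5); [Folland1989] Prop. (4.39), (4.76); [BorelJacquet1979] §4.6; [Rallis1984] Thm. 1.2.2.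
-/

set_option autoImplicit false
set_option linter.dupNamespace false

noncomputable section

open NumberField NumberField.InfinitePlace MeasureTheory IsDedekindDomain
open scoped Matrix ComplexOrder ENNReal TensorProduct SchwartzMap Kronecker Classical

namespace Summit.HodgeConjecture.HodgeConjecture.Cruxes.H413.F0P2oCcArchTypeAwayHolds

open _root_.MeasureTheory
open Literature.NumberTheory.Automorphic Literature.NumberTheory.Automorphic.UnitaryGroup
open Literature.NumberTheory.Automorphic.UnitaryGroup.CotangentForms
open Literature.NumberTheory.Automorphic.IdeleClassGroup
open Literature.NumberTheory.Automorphic.Liu2021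
open Literature.NumberTheory.Automorphic.Liu2021.Def411WeilCarriers
open Literature.NumberTheory.Automorphic.Liu2021.Def411WeilCarriersDoubling
open Literature.NumberTheory.GelbartRogawski1991 Literature.NumberTheory.GelbartRogawski1991.UnitaryDualPair
open Literature.NumberTheory.GelbartRogawski1991.GRConstruction
open Literature.NumberTheory.Weil1964
open Literature.RepresentationTheory.Liu2021
open Literature.RepresentationTheory.HeisenbergGroup Literature.Analysis.SegalBargmann
open Literature.RepresentationTheory.KonnoKonno2007 Literature.RepresentationTheory.CompactGroups
open Summit.HodgeConjecture.HodgeConjecture.Cruxes.H413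
open Summit.HodgeConjecture.HodgeConjecture.Cruxes.H413.F0P2oCcThetaFunctionalCovariance

set_option maxHeartbeats 4000000 in
-- (the letter's binder list and the theta telescope are large; every step is a named ★ lemma)
/-- **NODE Cc OF THE (C♯)hol INTERIOR HOLDS — ★ `Liu2021.meetsThetaLiftFromLine_hol_archTypeAway` PROVED** ([Liu2021, App. D Lem. D.2 (1)] applied off the place
of `ι`): the raw archimedean parameters of a holomorphic-cotangent `P` meeting the theta lift from `⟨a⟩` are `(m, sign) ∈ {(−1, −), (1, +)}` at every `τ′` with
`mk τ′ ≠ mk ι`.  See the module docstring for the road (every input ★). [cite: Liu2021, App. D Lem. D.2 (1) p. 127 (l. 5283); Prop. 4.13 proof Case 1 (l. 2137–2141, p. 48)]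
[cite: KonnoKonno2007, Thm. 5.4] [cite: Folland1989, Prop. (4.76)] [cite: BorelJacquet1979, §4.6] -/
theorem meetsThetaLiftFromLine_hol_archTypeAway_holds : Liu2021.meetsThetaLiftFromLine_hol_archTypeAway := by
  intro L _ _ _ ι H T hT hdef h2 n' e₁ dV hdV hdV0 g hg ιA hιA _ μA _ P μ hμ a hmeet hhol τ' hτ'
  haveI : CompactSpace (adelicGroupData (↥(maximalRealSubfield L)) L (IsCMField.complexConj L) 3 H).automorphicQuotient :=
    F0P3HolProjectionReduction.compactSpace_automorphicQuotient_cm hdef h2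
  -- S4: the transport is the canonical one
  obtain rfl := eq_cmAdelicFrameTransport_of_coe L 3 H dV g hg ιA hιA
  -- `IsHolCotangentAt`: a non-zero coordinate class of a holomorphic cotangent form in `P`
  obtain ⟨Φh, hΦh, hΦne, hcont⟩ := hhol
  have hm : ∀ j : Fin 2,
      MemLp (toQuotFun (adelicGroupData (↥(maximalRealSubfield L)) L (IsCMField.complexConj L) 3 H) fun x => Φh x j) 2 μA :=
    fun j => (hcont j).choose
  obtain ⟨j, hj⟩ := F0P2aCohFormsContinuous.exists_toLp_ne_zero_of_mem_cohForms_cm (holCotForms_le_cohForms hΦh) hΦne hm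
  -- node B (1b): a pure-tensor theta witness with non-zero projection
  letI : MeasurableSpace (↥(UnitaryGroup.adelic (↥(maximalRealSubfield L)) L (IsCMField.complexConj L) 1 (JW (↥(maximalRealSubfield L)) L a)) ⧸ (UnitaryGroup.toAdelic (↥(maximalRealSubfield L)) L (IsCMField.complexConj L) 1 (JW (↥(maximalRealSubfield L)) L a)).range) := borel _
  haveI : BorelSpace (↥(UnitaryGroup.adelic (↥(maximalRealSubfield L)) L (IsCMField.complexConj L) 1 (JW (↥(maximalRealSubfield L)) L a)) ⧸ (UnitaryGroup.toAdelic (↥(maximalRealSubfield L)) L (IsCMField.complexConj L) 1 (JW (↥(maximalRealSubfield L)) L a)).range) := ⟨rfl⟩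
  haveI := normal_range_toAdelic_JW L a
  obtain ⟨hρ, μW, hfinm, hinv, Φinf, Φfin, hfin, χ, hθ, hne⟩ :=
    hmeet.exists_chi_starProjection_ne_zero_of_holCotForm_tensor L ι H T hT e₁ dV hdV hdV0 g hg μ hμ a P hΦh (hm j)
      (hcont j).choose_spec hj
  haveI : IsFiniteMeasure μW := hfinm
  haveI : SMulInvariantMeasure ↥(UnitaryGroup.adelic (↥(maximalRealSubfield L)) L (IsCMField.complexConj L) 1 (JW (↥(maximalRealSubfield L)) L a)) (↥(UnitaryGroup.adelic (↥(maximalRealSubfield L)) L (IsCMField.complexConj L) 1 (JW (↥(maximalRealSubfield L)) L a)) ⧸ (UnitaryGroup.toAdelic (↥(maximalRealSubfield L)) L (IsCMField.complexConj L) 1 (JW (↥(maximalRealSubfield L)) L a)).range) μW := hinv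
  -- the witness as `E(Φ_∞ ⊗ Φ_f)`
  have hΨ : piSchwartzBruhatEquiv (↥(maximalRealSubfield L)) (Fin n') (Φinf ⊗ₜ[ℂ] (⟨Φfin, hfin⟩ : FinSB (↥(maximalRealSubfield L)) (Fin n'))) =
      ⟨fun v => Φinf (piArch (↥(maximalRealSubfield L)) (Fin n') v) * Φfin (piFinite (↥(maximalRealSubfield L)) (Fin n') v),
        tensor_mem_piSchwartzBruhat Φinf hfin⟩ :=
    Subtype.ext (coe_piSchwartzBruhatEquiv_tmul (↥(maximalRealSubfield L)) (Fin n') Φinf ⟨Φfin, hfin⟩)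
  -- the place of `τ′` and the real place below it
  let w₀ : {w : InfinitePlace L // w.IsComplex} := ⟨InfinitePlace.mk τ', IsTotallyComplex.isComplex _⟩
  let v₀ : {v : InfinitePlace (↥(maximalRealSubfield L)) // v.IsReal} :=
    ⟨w₀.1.comap (algebraMap (↥(maximalRealSubfield L)) L),
      Literature.NumberTheory.GelbartRogawski1991.UnitaryDualPair.ArchSplitting.QuadExt.isReal_comap_of_smul_eq (F := ↥(maximalRealSubfield L))
        (E := L) (c := IsCMField.complexConj L) (w := w₀) (complexConj_smul_infinitePlace L _) (IsCMField.complexConj_ne_one L)⟩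
  have hw₀ : (cmPlaceOver L v₀).1 = InfinitePlace.mk τ' :=
    comap_injective_of_isCMField (L := L) (cmPlaceOver_comap L v₀)
  have hw₀' : (cmPlaceOver L v₀).1 ≠ InfinitePlace.mk ι := hw₀ ▸ hτ'
  -- the archimedean type of `toHeckeCharacter μ`
  have hτ : (toHeckeCharacter L μ).HasUnitaryArchType hμ.infinityType 0 :=
    (hasUnitaryArchType_toHeckeCharacter_iff L μ _).2 hμ.hasInfinityType_infinityType
  have hodd : ∀ w, Odd (hμ.infinityType w) := hμ.odd_infinityType
  -- positivity of `σ_{v₀}(dV p)` and the sign split at `v₀`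
  have hH : (H.map (cmPlaceOver L v₀).1.embedding).PosDef :=
    hdef _ (by rw [InfinitePlace.mk_embedding]; exact hw₀')
  have hVpos := embedding_of_isReal_dV_pos_of_posDef L dV hdV v₀ H g hg hH
  -- the dictionary at `τ′`: `τ′ = σ_{w₀}` or its conjugate
  have hmk : InfinitePlace.mk τ' = InfinitePlace.mk (cmPlaceOver L v₀).1.embedding := by rw [InfinitePlace.mk_embedding, hw₀]
  have hτ'or : τ' = (cmPlaceOver L v₀).1.embedding ∨ τ' = NumberField.ComplexEmbedding.conjugate (cmPlaceOver L v₀).1.embedding := by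
    rcases InfinitePlace.mk_eq_iff.1 hmk with h | h
    · exact Or.inl h
    · refine Or.inr (RingHom.ext fun z => ?_)
      have hz := congrArg (fun φ : L →+* ℂ => φ z) h
      simp only [NumberField.ComplexEmbedding.conjugate_coe_eq] at hz
      rw [NumberField.ComplexEmbedding.conjugate_coe_eq, ← hz, Complex.conj_conj]
  have hIm : ((cmPlaceOver L v₀).1.embedding (algebraMap (↥(maximalRealSubfield L)) L a * (2 * imagUnit L)⁻¹)).im =
      -embedding_of_isReal v₀.2 (a : ↥(maximalRealSubfield L)) / (2 * deltaIm (cmPlaceOver L) (imagUnit L) v₀) :=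
    im_embedding_cmPlaceOver_mul_inv_two_imagUnit L v₀ (a : ↥(maximalRealSubfield L))
  have hImc : (NumberField.ComplexEmbedding.conjugate (cmPlaceOver L v₀).1.embedding
        (algebraMap (↥(maximalRealSubfield L)) L a * (2 * imagUnit L)⁻¹)).im =
      embedding_of_isReal v₀.2 (a : ↥(maximalRealSubfield L)) / (2 * deltaIm (cmPlaceOver L) (imagUnit L) v₀) := by
    rw [NumberField.ComplexEmbedding.conjugate_coe_eq, Complex.conj_im, hIm, neg_div, neg_neg]
  -- the sign of `x_{v₀}` read on `σ_{v₀}(a) / c_{v₀}` (S3a at `k := e₁ (p, 0)`)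
  have hsign : ∀ p : Fin 3, signVec (cmPlaceOver L) (cmGramEntry L e₁ dV hdV (lineW L (TW (↥(maximalRealSubfield L)) a))
      (complexConj_lineW L (TW (↥(maximalRealSubfield L)) a))) (imagUnit L) v₀ (e₁ (p, 0)) =
      embedding_of_isReal v₀.2 (⟨dV p, (IsCMField.complexConj_eq_self_iff (K := L) (dV p)).1 (hdV p)⟩ : ↥(maximalRealSubfield L)) *
        (embedding_of_isReal v₀.2 (a : ↥(maximalRealSubfield L)) / deltaIm (cmPlaceOver L) (imagUnit L) v₀) := fun p => by
    rw [signVec_cmGramEntry_eq, Equiv.symm_apply_apply, mul_div_assoc]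
    rfl
  have hd0 : deltaIm (cmPlaceOver L) (imagUnit L) v₀ ≠ 0 :=
    deltaIm_ne_zero (IsCMField.complexConj_ne_one L) (cmPlaceOver_smul L) (complexConj_imagUnit L) (imagUnit_ne_zero L) v₀
  -- the core: kill the witness unless the exponent at `w₀` is right
  have hkill : ∀ {ε : ℤ}, (∀ (Φf : FinSB (↥(maximalRealSubfield L)) (Fin n')) (φ : 𝓢((Fin n' → mixedEmbedding.mixedSpace ↥(maximalRealSubfield L)), ℂ)),
      ε ≠ 0 → P.space.toSubmodule.starProjection (MemLp.toLp _ (memLp_toQuotFun_lineThetaLift L 3 H e₁ dV hdV hdV0 g hg μ hμ a hρ μW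
        (piSchwartzBruhatEquiv (↥(maximalRealSubfield L)) (Fin n') (φ ⊗ₜ Φf))
        (charCM (chiQuot (↥(maximalRealSubfield L)) L (IsCMField.complexConj L) (Algebra.IsQuadraticExtension.finrank_eq_two _ L)
          (IsCMField.complexConj_ne_one (K := L)) a χ)) μA 2)) = 0) → ε = 0 := by
    intro ε hcore
    by_contra hε
    apply hne
    rw [show MemLp.toLp _ hθ = MemLp.toLp _ (memLp_toQuotFun_lineThetaLift L 3 H e₁ dV hdV hdV0 g hg μ hμ a hρ μW
        ⟨fun v => Φinf (piArch (↥(maximalRealSubfield L)) (Fin n') v) * Φfin (piFinite (↥(maximalRealSubfield L)) (Fin n') v),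
          tensor_mem_piSchwartzBruhat Φinf hfin⟩
        (charCM (chiQuot (↥(maximalRealSubfield L)) L (IsCMField.complexConj L) (Algebra.IsQuadraticExtension.finrank_eq_two _ L)
          (IsCMField.complexConj_ne_one (K := L)) a χ)) μA 2) from rfl,
      ← toLp_lineThetaLift_congr L 3 H e₁ dV hdV hdV0 g hg μ hμ a hρ μW _ μA hΨ]
    exact hcore ⟨Φfin, hfin⟩ Φinf hε
  rcases forall_signVec_pos_or_forall_not_of_line L dV hdV v₀ e₁ (lineW L (TW (↥(maximalRealSubfield L)) a))
    (complexConj_lineW L (TW (↥(maximalRealSubfield L)) a)) hVpos with hpos | hneg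
  · -- POSITIVE at `v₀`: `τ_{w₀} = −1` and `Im σ_{w₀}(a·(2δ)⁻¹) < 0`
    have hτw : hμ.infinityType (cmPlaceOver L v₀).1 = -1 := by
      obtain ⟨m, hm'⟩ := hodd (cmPlaceOver L v₀).1
      have h0 : (hμ.infinityType (cmPlaceOver L v₀).1 + 1) / 2 = 0 :=
        hkill fun Φf φ hm0 => starProjection_toLp_lineThetaLift_tmul_eq_zero_of_pos L ι H T hT e₁ dV hdV hdV0 g hg μ hμ a hρ μW _ P hΦh
          (hm j) (hcont j).choose_spec hj v₀ hw₀' hτ hodd hpos hm0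
          (fun A => exists_archLocal_entries_eq_of_pos L e₁ dV hdV hdV0 (lineW L (TW (↥(maximalRealSubfield L)) a))
            (complexConj_lineW L (TW (↥(maximalRealSubfield L)) a)) (lineW_ne_zero L (TW (↥(maximalRealSubfield L)) a) (isUnit_det_TW (↥(maximalRealSubfield L)) a))
            v₀ hpos A)
          (fun W β => carrierConjEquiv_frameD_placeBlock_mulSingle_doubled_archBoxTensor L e₁ dV hdV hdV0 (lineW L (TW (↥(maximalRealSubfield L)) a))
            (complexConj_lineW L (TW (↥(maximalRealSubfield L)) a)) (lineW_ne_zero L (TW (↥(maximalRealSubfield L)) a) (isUnit_det_TW (↥(maximalRealSubfield L)) a))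
            W v₀ β 0)
          Φf φ
      omega
    -- the sign: `0 < σ_{v₀}(a) / c_{v₀}`
    have hs : 0 < embedding_of_isReal v₀.2 (a : ↥(maximalRealSubfield L)) / deltaIm (cmPlaceOver L) (imagUnit L) v₀ := by
      have h := hpos (e₁ ((0 : Fin 3), 0))
      rw [hsign] at h
      exact (mul_pos_iff_of_pos_left (hVpos 0)).1 h
    rcases hτ'or with hτ'eq | hτ'eq
    · left
      refine ⟨by rw [hτ'eq, exponentAt_embedding, hτw], ?_⟩
      rw [hτ'eq, hIm, neg_div, neg_lt_zero, mul_comm (2 : ℝ), ← div_div]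
      exact div_pos hs two_pos
    · right
      refine ⟨by rw [hτ'eq, exponentAt_conjugate_embedding _ (cmPlaceOver L v₀).2, hτw]; norm_num, ?_⟩
      rw [hτ'eq, hImc, mul_comm (2 : ℝ), ← div_div]
      exact div_pos hs two_pos
  · -- NEGATIVE at `v₀`: `τ_{w₀} = 1` and `0 < Im σ_{w₀}(a·(2δ)⁻¹)`
    have hτw : hμ.infinityType (cmPlaceOver L v₀).1 = 1 := by
      obtain ⟨m, hm'⟩ := hodd (cmPlaceOver L v₀).1
      have h0 : (1 - hμ.infinityType (cmPlaceOver L v₀).1) / 2 = 0 :=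
        hkill fun Φf φ hm0 => starProjection_toLp_lineThetaLift_tmul_eq_zero_of_neg L ι H T hT e₁ dV hdV hdV0 g hg μ hμ a hρ μW _ P hΦh
          (hm j) (hcont j).choose_spec hj v₀ hw₀' hτ hodd hneg hm0
          (fun A => exists_archLocal_entries_eq_of_neg L e₁ dV hdV hdV0 (lineW L (TW (↥(maximalRealSubfield L)) a))
            (complexConj_lineW L (TW (↥(maximalRealSubfield L)) a)) (lineW_ne_zero L (TW (↥(maximalRealSubfield L)) a) (isUnit_det_TW (↥(maximalRealSubfield L)) a))
            v₀ hneg A)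
          (fun W β => carrierConjEquiv_frameD_placeBlock_mulSingle_doubled_archBoxTensor L e₁ dV hdV hdV0 (lineW L (TW (↥(maximalRealSubfield L)) a))
            (complexConj_lineW L (TW (↥(maximalRealSubfield L)) a)) (lineW_ne_zero L (TW (↥(maximalRealSubfield L)) a) (isUnit_det_TW (↥(maximalRealSubfield L)) a))
            W v₀ β 0)
          Φf φ
      omega
    -- the sign: `σ_{v₀}(a) / c_{v₀} < 0`
    have hs : embedding_of_isReal v₀.2 (a : ↥(maximalRealSubfield L)) / deltaIm (cmPlaceOver L) (imagUnit L) v₀ < 0 := by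
      have h := hneg (e₁ ((0 : Fin 3), 0))
      rw [hsign] at h
      have hne0 : embedding_of_isReal v₀.2 (a : ↥(maximalRealSubfield L)) / deltaIm (cmPlaceOver L) (imagUnit L) v₀ ≠ 0 :=
        div_ne_zero ((map_ne_zero _).2 (Units.ne_zero a)) hd0
      rcases lt_trichotomy (embedding_of_isReal v₀.2 (a : ↥(maximalRealSubfield L)) / deltaIm (cmPlaceOver L) (imagUnit L) v₀) 0 with hlt | heq | hgt
      · exact hlt
      · exact absurd heq hne0
      · exact absurd (mul_pos (hVpos 0) hgt) h
    rcases hτ'or with hτ'eq | hτ'eq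
    · right
      refine ⟨by rw [hτ'eq, exponentAt_embedding, hτw], ?_⟩
      rw [hτ'eq, hIm, neg_div, mul_comm (2 : ℝ), ← div_div]
      exact neg_pos.2 (div_neg_of_neg_of_pos hs two_pos)
    · left
      refine ⟨by rw [hτ'eq, exponentAt_conjugate_embedding _ (cmPlaceOver L v₀).2, hτw], ?_⟩
      rw [hτ'eq, hImc, mul_comm (2 : ℝ), ← div_div]
      exact div_neg_of_neg_of_pos hs two_pos

end Summit.HodgeConjecture.HodgeConjecture.Cruxes.H413.F0P2oCcArchTypeAwayHolds

end
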